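import Summits.HodgeConjecture.HodgeConjecture.Theorems.R90S4EpsSingularNull        -- ★ SING-ε (R90-C131-p04): the one-place model `(localGLPiEquiv L 3 v).trans (localGLPiEvalEquiv c 3 hc w hw)`, `map_eval_epsNorm_eq` pattern; brings ★ `localGLPiEvalEquiv`, ★ `conjLocal_apply_of_smul_eq`, ★ `AdicCompletionLocalField`, ★ `splitFormGL`, ★ `epsLoc`
import Literature.NumberTheory.Automorphic.ValuedFieldValuativeRelBridge                 -- ★ `v_le_iff_valuation_le` (`Valued.v` ↔ `ValuativeRel.valuation`)
import Literature.NumberTheory.Automorphic.GLnCongruenceSubgroups                        -- ★ `ValBound`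
import HarnessLib

/-!
# R90-TF · S4 «Ch. 13.1–2», road (J̃♭) «TWISTED TUBE JACOBIAN», DATUM BRIDGE LETTERS — THE ONE-PLACE MODEL OF `G̃_v = GL₃(L ⊗ L⁺_v)` AT A NON-SPLIT PLACE:
# the thirteen measure-free letters (`ρ`, `σ_w`, `J_w`, `ε_v`, regularity, centralisers) that ★ (M-3b) `twistedTubeJacobianLocal_model` asks of its frame

Cell `hodgecm-mathlib`, crux H413 (`stmt-HodgeConjecture-24833`, lane `--supports … --as helper`), route of record `HCCMUnconditional` (no route verbs; count-neutral).
Programme R90-TF, section S4 = [Rogawski1990] Ch. 13.1–13.2.  Seat K2E3-p36 (g4); the LETTERS half of the (J̃♭) DATUM BRIDGE (K2E4-p11 (g10) 2026-09-05T03:54:22Z «CUT + LETTER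
BYTES»: names and types fixed there; K2E4-p11's `R90S4TwistedTubeModelGtLoc` consumes them by name).  THEOREMS ONLY — no `def`, no instance, no notation, no named-fact
hypothesis, no `sorry`; ★-only imports.

HONEST LABEL: HC_CM is proved only modulo the 7 printed citations (2 remaining named inputs: hLiu418 = stmt-HodgeConjecture-24832, h413 = stmt-HodgeConjecture-24833)
until rung 0 closes.  Pure algebra of the one-place model; letters pay nothing by themselves ((J̃♭)∕(W-NP) stay OPEN until R90-C131-p31's `twistedTubeJacobian_of_record`).

## The mathematics

At a place `v` of `L⁺` NON-SPLIT in the CM field `L` there is exactly one place `w ∣ v`, fixed by complex conjugation `c` (`hw : c • w = w`).  Evaluation at `w`,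
`π_w : L ⊗_{L⁺} L⁺_v = ∏_{w′∣v} L_{w′} → K := L_w`, identifies `G̃_v = GL₃(L ⊗ L⁺_v)` with `GL₃(K)` — as a topological group the identification is ★ SING-ε's
`(localGLPiEquiv L 3 v).trans (localGLPiEvalEquiv c 3 hc w hw)`.  To keep the consumer free of that coercion path the model enters HYPOTHESIS-FIRST: any
`ρ : G̃_v →* GL₃(K)` with `hρπ : ρ δ = δ.map π_w` entrywise (the equivalence satisfies it by `rfl`).  We record, with `σ_w := galAdicCompletionMap c hw` (the
continuous extension of `c` to `K`) and `J_w := (splitForm L 3).map (algebraMap L K)` (the antidiagonal unit form of record read in `K`):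
* §1 `ρ` is inducing, injective, surjective (it IS the equivalence, pointwise);
* §2 `σ_w` preserves the valuation (★ `valued_galAdicCompletionMap`, read in `ValuativeRel.valuation` through ★ `v_le_iff_valuation_le`);
* §3 `J_w² = 1`, `J_w⁻¹ = J_w`, `det J_w` a unit, `(J_w.map σ_w)ᵀ = J_w` (entries `0, 1`), `J_w` and `J_w⁻¹` integral (`ValBound 1`);
* §4 **the twist read in the model**: `ρ(ε_v g) = J_w⁻¹ · ((ρ g)⁻¹.map σ_w)ᵀ · J_w` — ★ `twistLocal_apply` (`ε_v(g) = Φ⁻¹ ((σ g)ᵀ)⁻¹ (Φ⁻¹)⁻¹` over `L ⊗ L⁺_v`) pushed through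
  `π_w` by ★ `conjLocal_apply_of_smul_eq` (`π_w ∘ (c ⊗ 1) = σ_w ∘ π_w`), exactly the `hερ` letter of ★ (M-3b);
* §5 regularity and centralisers transport: `ρ g` has separable characteristic polynomial for regular `g` (`Matrix.charpoly_map`, `Polynomial.Separable.map`), and
  `g ∈ Cent(γ₀) ↔ ρ g · ρ γ₀ = ρ γ₀ · ρ g` (injectivity).

[cite: Rogawski1990, §3.10 p. 33; §3.11 p. 34; §4.10 p. 57; §12.2 p. 171] [cite: CasselsFrohlichANT1967, Ch. II §10; Ch. VII §1.1]
-/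

set_option autoImplicit false
-- the mandated namespace repeats the single-problem summit's segment (`HodgeConjecture.HodgeConjecture`)
set_option linter.dupNamespace false

noncomputable section

open Polynomial Matrix Function Set NumberField IsDedekindDomain Topology ValuativeRel
open Literature.NumberTheory.Automorphic Literature.NumberTheory.Automorphic.UnitaryGroup
open Literature.NumberTheory.Rogawski1990 Literature.NumberTheory.GaloisRepresentations
open Summit.HodgeConjecture.HodgeConjecture.Cruxes.H413
open Summit.HodgeConjecture.HodgeConjecture.Cruxes.HLiu418
open Summit.HodgeConjecture.HodgeConjecture.Cruxes.H413.K2E1GlobalTestFunctionsTwisted (formLocal twistLocal twistLocal_apply)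
open Summit.HodgeConjecture.HodgeConjecture.Cruxes.H413.F0P3InnerFormClassificationV6 (splitForm)
open scoped MatrixGroups

namespace Summit.HodgeConjecture.HodgeConjecture.R90.S4

section GtLocLetters

variable (L : Type) [Field L] [NumberField L] [IsCMField L] (v : HeightOneSpectrum (𝓞 ↥(maximalRealSubfield L)))
  (w : PlacesOver L v) (hw : IsCMField.complexConj L • w.1 = w.1)

/-! ## §1 The model `ρ` is the one-place equivalence: inducing, injective, surjective -/

include hw in
/-- **Any entrywise-`π_w` model IS the one-place equivalence**: for `ρ : G̃_v →* GL₃(L_w)` with `ρ δ = δ.map π_w` there is an isomorphism of topological groups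
`e : G̃_v ≃ₜ* GL₃(L_w)` (★ SING-ε's `(localGLPiEquiv L 3 v).trans (localGLPiEvalEquiv c 3 hc w hw)`) with `⇑ρ = ⇑e`. [cite: CasselsFrohlichANT1967, Ch. II §10] -/
theorem gtLocModel_exists_continuousMulEquiv (ρ : GtLoc L v →* GL (Fin 3) (w.1.adicCompletion L))
    (hρπ : ∀ δ : GtLoc L v, ((ρ δ : GL (Fin 3) (w.1.adicCompletion L)) : Matrix (Fin 3) (Fin 3) (w.1.adicCompletion L)) =
      δ.val.map (Pi.evalRingHom (fun w' : PlacesOver L v => w'.1.adicCompletion L) w)) :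
    ∃ e : GtLoc L v ≃ₜ* GL (Fin 3) (w.1.adicCompletion L), (ρ : GtLoc L v → GL (Fin 3) (w.1.adicCompletion L)) = e := by
  have hc : IsCMField.complexConj L ≠ 1 := IsCMField.complexConj_ne_one L
  refine ⟨(localGLPiEquiv L 3 v).trans (localGLPiEvalEquiv (IsCMField.complexConj L) 3 hc w hw), funext fun δ => Units.ext ?_⟩
  rw [hρπ]
  rfl

include hw in
/-- **(1) `ρ` is inducing** (it is a homeomorphism onto `GL₃(L_w)`). [cite: CasselsFrohlichANT1967, Ch. II §10] -/
theorem gtLocModel_isInducing (ρ : GtLoc L v →* GL (Fin 3) (w.1.adicCompletion L))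
    (hρπ : ∀ δ : GtLoc L v, ((ρ δ : GL (Fin 3) (w.1.adicCompletion L)) : Matrix (Fin 3) (Fin 3) (w.1.adicCompletion L)) =
      δ.val.map (Pi.evalRingHom (fun w' : PlacesOver L v => w'.1.adicCompletion L) w)) :
    IsInducing ρ := by
  obtain ⟨e, he⟩ := gtLocModel_exists_continuousMulEquiv L v w hw ρ hρπ
  rw [he]
  exact e.toHomeomorph.isInducing

include hw in
/-- **(2) `ρ` is injective.** [cite: CasselsFrohlichANT1967, Ch. II §10] -/
theorem gtLocModel_injective (ρ : GtLoc L v →* GL (Fin 3) (w.1.adicCompletion L))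
    (hρπ : ∀ δ : GtLoc L v, ((ρ δ : GL (Fin 3) (w.1.adicCompletion L)) : Matrix (Fin 3) (Fin 3) (w.1.adicCompletion L)) =
      δ.val.map (Pi.evalRingHom (fun w' : PlacesOver L v => w'.1.adicCompletion L) w)) :
    Function.Injective ρ := by
  obtain ⟨e, he⟩ := gtLocModel_exists_continuousMulEquiv L v w hw ρ hρπ
  rw [he]
  exact e.injective

include hw in
/-- **(3) `ρ` is surjective.** [cite: CasselsFrohlichANT1967, Ch. II §10] -/
theorem gtLocModel_surjective (ρ : GtLoc L v →* GL (Fin 3) (w.1.adicCompletion L))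
    (hρπ : ∀ δ : GtLoc L v, ((ρ δ : GL (Fin 3) (w.1.adicCompletion L)) : Matrix (Fin 3) (Fin 3) (w.1.adicCompletion L)) =
      δ.val.map (Pi.evalRingHom (fun w' : PlacesOver L v => w'.1.adicCompletion L) w)) :
    Function.Surjective ρ := by
  obtain ⟨e, he⟩ := gtLocModel_exists_continuousMulEquiv L v w hw ρ hρπ
  rw [he]
  exact e.surjective

/-! ## §2 The Galois involution of `L_w` preserves the valuation -/

/-- **(4) `σ_w = galAdicCompletionMap c hw` preserves the valuation**: `valuation (σ_w x) ≤ valuation x` (indeed `=`; ★ `valued_galAdicCompletionMap` read in the valuative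
relation of ★ `AdicCompletionLocalField` through ★ `v_le_iff_valuation_le`) — the `hσv` letter of ★ (M-3b). [cite: CasselsFrohlichANT1967, Ch. VII §1.1] -/
theorem valuation_galAdicCompletionMap_cm_le (x : w.1.adicCompletion L) :
    valuation (w.1.adicCompletion L) (galAdicCompletionMap (L := L) (IsCMField.complexConj L) hw x) ≤ valuation (w.1.adicCompletion L) x :=
  (v_le_iff_valuation_le _ _).1 (valued_galAdicCompletionMap (L := L) (IsCMField.complexConj L) hw x).le

include hw in
/-- **(4′) `σ_w` is not the identity**: there is `u ∈ L_w` with `σ_w u ≠ u` — indeed a unit `λ` with `σ_w λ = −λ` (★ `exists_units_galAdicCompletionMap_eq_neg`; `λ ≠ 0` and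
`char L_w = 0`).  The `hσne` letter R90-C131-p31's Σ-2 feeds to ★ `exists_antiFixed_scalar`. [cite: CasselsFrohlichANT1967, Ch. VII §1.1] -/
theorem exists_galAdicCompletionMap_cm_ne_self :
    ∃ u : w.1.adicCompletion L, galAdicCompletionMap (L := L) (IsCMField.complexConj L) hw u ≠ u := by
  have hc : IsCMField.complexConj L ≠ 1 := IsCMField.complexConj_ne_one L
  haveI : CharZero (w.1.adicCompletion L) := charZero_of_injective_algebraMap (algebraMap L (w.1.adicCompletion L)).injective
  obtain ⟨lam, hlam⟩ := exists_units_galAdicCompletionMap_eq_neg (IsCMField.complexConj L) hc v w hw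
  refine ⟨(lam : w.1.adicCompletion L), ?_⟩
  rw [hlam]
  intro h
  exact lam.ne_zero (CharZero.neg_eq_self_iff.1 h)

/-! ## §3 The antidiagonal unit form `J_w = (splitForm L 3).map (algebraMap L L_w)` -/

omit [IsCMField L] in
/-- **(5) `J_w · J_w = 1`** (★ `splitForm_three_mul_self` mapped). [cite: Rogawski1990, §12.2 p. 171] -/
theorem splitFormPlace_mul_self :
    (splitForm L 3).map (algebraMap L (w.1.adicCompletion L)) * (splitForm L 3).map (algebraMap L (w.1.adicCompletion L)) = 1 := by
  rw [← Matrix.map_mul, splitForm_three_mul_self, Matrix.map_one _ (map_zero _) (map_one _)]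

omit [IsCMField L] in
/-- **(6) `J_w⁻¹ = J_w`.** [cite: Rogawski1990, §12.2 p. 171] -/
theorem splitFormPlace_inv :
    ((splitForm L 3).map (algebraMap L (w.1.adicCompletion L)))⁻¹ = (splitForm L 3).map (algebraMap L (w.1.adicCompletion L)) :=
  Matrix.inv_eq_left_inv (splitFormPlace_mul_self L v w)

omit [IsCMField L] in
/-- **(7) `det J_w` is a unit** — the `hJ` letter of ★ (M-3b). [cite: Rogawski1990, §12.2 p. 171] -/
theorem isUnit_det_splitFormPlace : IsUnit ((splitForm L 3).map (algebraMap L (w.1.adicCompletion L))).det :=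
  Matrix.isUnit_det_of_left_inverse (splitFormPlace_mul_self L v w)

/-- **(8) `J_w` is `σ_w`-hermitian: `(J_w.map σ_w)ᵀ = J_w`** (entries `0, 1`) — the `hJh` letter of ★ (M-3b). [cite: Rogawski1990, §12.2 p. 171] -/
theorem splitFormPlace_map_transpose :
    (((splitForm L 3).map (algebraMap L (w.1.adicCompletion L))).map (galAdicCompletionMap (L := L) (IsCMField.complexConj L) hw))ᵀ =
      (splitForm L 3).map (algebraMap L (w.1.adicCompletion L)) := by
  refine Matrix.ext fun i j => ?_
  fin_cases i <;> fin_cases j <;> simp [splitForm]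

omit [IsCMField L] in
/-- **(9) `J_w` is integral: `ValBound 1 J_w`** (entries `0, 1`) — the `hJ1` letter of ★ (M-3b). [cite: Rogawski1990, §12.2 p. 171] -/
theorem valBound_one_splitFormPlace : ValBound 1 ((splitForm L 3).map (algebraMap L (w.1.adicCompletion L))) := by
  intro i j
  fin_cases i <;> fin_cases j <;> simp [splitForm]

omit [IsCMField L] in
/-- **(10) `J_w⁻¹` is integral: `ValBound 1 J_w⁻¹`** (`J_w⁻¹ = J_w`) — the `hJi1` letter of ★ (M-3b). [cite: Rogawski1990, §12.2 p. 171] -/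
theorem valBound_one_splitFormPlace_inv : ValBound 1 ((splitForm L 3).map (algebraMap L (w.1.adicCompletion L)))⁻¹ := by
  rw [splitFormPlace_inv]
  exact valBound_one_splitFormPlace L v w

/-! ## §4 The twist `ε_v` read in the model -/

/-- **(11) THE TWIST IN THE ONE-PLACE MODEL: `ρ(ε_v g) = J_w⁻¹ · ((ρ g)⁻¹.map σ_w)ᵀ · J_w`** — the `hερ` letter of ★ (M-3b) at `J := J_w`, `σ := σ_w`.  Over `L ⊗ L⁺_v`,
`ε_v(g) = Φ⁻¹ · ((σ g)⁻¹)ᵀ · (Φ⁻¹)⁻¹` with `Φ = splitFormGL L`, `σ = c ⊗ 1` (★ `twistLocal_apply`); `Φ⁻¹` and `(Φ⁻¹)⁻¹` both read `J = splitForm L 3` (★ `coe_inv_splitFormGL`,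
`J² = 1`), `π_w ∘ (c ⊗ 1) = σ_w ∘ π_w` (★ `conjLocal_apply_of_smul_eq`), and a ring homomorphism commutes with matrix inversion and transpose.
[cite: Rogawski1990, §3.10 p. 33; §3.11 p. 34; §4.10 p. 57] [cite: CasselsFrohlichANT1967, Ch. VII §1.1] -/
theorem gtLocModel_epsLoc (ρ : GtLoc L v →* GL (Fin 3) (w.1.adicCompletion L))
    (hρπ : ∀ δ : GtLoc L v, ((ρ δ : GL (Fin 3) (w.1.adicCompletion L)) : Matrix (Fin 3) (Fin 3) (w.1.adicCompletion L)) =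
      δ.val.map (Pi.evalRingHom (fun w' : PlacesOver L v => w'.1.adicCompletion L) w))
    (g : GtLoc L v) :
    ((ρ (epsLoc L (splitFormGL L) v g) : GL (Fin 3) (w.1.adicCompletion L)) : Matrix (Fin 3) (Fin 3) (w.1.adicCompletion L)) =
      ((splitForm L 3).map (algebraMap L (w.1.adicCompletion L)))⁻¹ *
        ((((ρ g)⁻¹ : GL (Fin 3) (w.1.adicCompletion L)) : Matrix (Fin 3) (Fin 3) (w.1.adicCompletion L)).map
          (galAdicCompletionMap (L := L) (IsCMField.complexConj L) hw))ᵀ *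
        (splitForm L 3).map (algebraMap L (w.1.adicCompletion L)) := by
  set c := IsCMField.complexConj L with hcdef
  have hc : c ≠ 1 := IsCMField.complexConj_ne_one L
  set π := Pi.evalRingHom (fun w' : PlacesOver L v => w'.1.adicCompletion L) w with hπ
  -- `(ρ g)⁻¹.map σ_w = ((ρ g).map σ_w)⁻¹`
  have hinvρ : ((((ρ g)⁻¹ : GL (Fin 3) (w.1.adicCompletion L)) : Matrix (Fin 3) (Fin 3) (w.1.adicCompletion L))).map (galAdicCompletionMap (L := L) c hw) =
      ((((ρ g : GL (Fin 3) (w.1.adicCompletion L)) : Matrix (Fin 3) (Fin 3) (w.1.adicCompletion L))).map (galAdicCompletionMap (L := L) c hw))⁻¹ := by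
    have h1 : ((((ρ g)⁻¹ : GL (Fin 3) (w.1.adicCompletion L)) : Matrix (Fin 3) (Fin 3) (w.1.adicCompletion L))).map (galAdicCompletionMap (L := L) c hw) =
        ((Matrix.GeneralLinearGroup.map (galAdicCompletionMap (L := L) c hw) (ρ g)⁻¹ : GL (Fin 3) (w.1.adicCompletion L)) :
          Matrix (Fin 3) (Fin 3) (w.1.adicCompletion L)) := rfl
    rw [h1, map_inv, Matrix.coe_units_inv]
    rfl
  -- `((c ⊗ 1) g)⁻¹` read through `π_w` (★ SING-ε's `hinv` block)
  have hI : ∀ x : UnitaryGroup.LocalRing L v, π (conjLocal L c v x) = galAdicCompletionMap (L := L) c hw (π x) := fun x =>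
    K2LiuLocalRingInertReading.conjLocal_apply_of_smul_eq c hc v w hw x
  have hinv : (((Matrix.GeneralLinearGroup.map (conjLocal L c v) g)⁻¹).val).map π =
      ((g.val.map π).map (galAdicCompletionMap (L := L) c hw))⁻¹ := by
    have h1 : (((Matrix.GeneralLinearGroup.map (conjLocal L c v) g)⁻¹).val).map π =
        (Matrix.GeneralLinearGroup.map π ((Matrix.GeneralLinearGroup.map (conjLocal L c v) g)⁻¹)).val := rfl
    rw [h1, map_inv, Matrix.coe_units_inv]
    congr 1
    refine Matrix.ext fun i j => ?_
    show π (conjLocal L c v (g.val i j)) = _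
    rw [Matrix.map_apply, Matrix.map_apply]
    exact hI _
  -- the twist over `L ⊗ L⁺_v`
  have hε : (epsLoc L (splitFormGL L) v g).val =
      ((formLocal L 3 (splitFormGL L) v)⁻¹).val * (((Matrix.GeneralLinearGroup.map (conjLocal L c v) g)⁻¹).val)ᵀ * ((formLocal L 3 (splitFormGL L) v)⁻¹⁻¹).val := by
    rw [epsLoc_apply, twistLocal_apply, Units.val_mul, Units.val_mul, coe_glTransposeInv_apply]
  -- the two form factors read `J_w` at `w`
  have hB : (((formLocal L 3 (splitFormGL L) v)⁻¹).val).map π = (splitForm L 3).map (algebraMap L (w.1.adicCompletion L)) := by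
    rw [show ((formLocal L 3 (splitFormGL L) v)⁻¹).val = (splitForm L 3).map (algebraMap L (UnitaryGroup.LocalRing L v)) from rfl, Matrix.map_map]
    rfl
  have hC : (((formLocal L 3 (splitFormGL L) v)⁻¹⁻¹).val).map π = (splitForm L 3).map (algebraMap L (w.1.adicCompletion L)) := by
    rw [show ((formLocal L 3 (splitFormGL L) v)⁻¹⁻¹).val = (splitForm L 3).map (algebraMap L (UnitaryGroup.LocalRing L v)) from rfl, Matrix.map_map]
    rfl
  rw [hinvρ, hρπ, hρπ, hε, Matrix.map_mul, Matrix.map_mul, Matrix.transpose_map, hinv, hB, hC, splitFormPlace_inv]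

/-! ## §5 Regularity and centralisers in the model -/

omit [IsCMField L] in
/-- **(12) Regular elements have separable characteristic polynomial in the model**: `IsRegularElt g → (ρ g).charpoly.Separable` (`(g.map π_w).charpoly = g.charpoly.map π_w`,
Mathlib `Matrix.charpoly_map`, `Polynomial.Separable.map`) — the `hγsep`∕`hsep` letters of ★ (M-3b). [cite: Rogawski1990, §3.11 p. 34] -/
theorem gtLocModel_separable_charpoly (ρ : GtLoc L v →* GL (Fin 3) (w.1.adicCompletion L))
    (hρπ : ∀ δ : GtLoc L v, ((ρ δ : GL (Fin 3) (w.1.adicCompletion L)) : Matrix (Fin 3) (Fin 3) (w.1.adicCompletion L)) =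
      δ.val.map (Pi.evalRingHom (fun w' : PlacesOver L v => w'.1.adicCompletion L) w))
    {g : GtLoc L v} (hg : IsRegularElt g) :
    (((ρ g : GL (Fin 3) (w.1.adicCompletion L)) : Matrix (Fin 3) (Fin 3) (w.1.adicCompletion L))).charpoly.Separable := by
  rw [hρπ, Matrix.charpoly_map]
  exact ((isRegularElt_iff g).1 hg).map

include hw in
/-- **(13) Centralisers transport to the model**: `g ∈ Cent_{G̃_v}(γ₀) ↔ ρ g · ρ γ₀ = ρ γ₀ · ρ g` (injectivity of `ρ`) — the `hT` letter of ★ (M-3b) at `γ := ρ γ₀`.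
[cite: Rogawski1990, §3.11 p. 34; §12.5 p. 186] -/
theorem gtLocModel_mem_centralizer_iff (ρ : GtLoc L v →* GL (Fin 3) (w.1.adicCompletion L))
    (hρπ : ∀ δ : GtLoc L v, ((ρ δ : GL (Fin 3) (w.1.adicCompletion L)) : Matrix (Fin 3) (Fin 3) (w.1.adicCompletion L)) =
      δ.val.map (Pi.evalRingHom (fun w' : PlacesOver L v => w'.1.adicCompletion L) w))
    (γ₀ g : GtLoc L v) :
    g ∈ Subgroup.centralizer ({γ₀} : Set (GtLoc L v)) ↔ ρ g * ρ γ₀ = ρ γ₀ * ρ g := by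
  rw [Subgroup.mem_centralizer_singleton_iff, ← map_mul, ← map_mul, (gtLocModel_injective L v w hw ρ hρπ).eq_iff]

end GtLocLetters

end Summit.HodgeConjecture.HodgeConjecture.R90.S4

end
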